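import Summits.BirchSwinnertonDyer.BirchSwinnertonDyer.Theorems.PrintCf2RamifiedOffTYZQFormPinned
import Summits.BirchSwinnertonDyer.BirchSwinnertonDyer.Theorems.PrintCf2RamifiedOffTYZQFormOddForest
import Literature.LinearAlgebra.Matrix.AdjugateRankOne
import HarnessLib

/-!
# Route `PrintCf2`, crux stmt-BirchSwinnertonDyer-20509 `RamifiedOffTYZOfFacts` — the Q-form identity (★)₆ for `n ≡ 6 (mod 8)`: EVEN FOREST LAYER
# (cell `bsd-print-cf2`, LEAD of 20509 g9, line `offtyz-v7`, cycle 10; kernel helpers `--supports stmt-BirchSwinnertonDyer-20509`)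

First kernel layer of the proof of **(★)₆** — the LEAD g8's identity for the `(inl i, inr i)` cofactor of Monsky's EVEN matrix
(crux workfile `Cruxes/RamifiedOffTYZOfFacts/Lines/offtyz_v7_SevenSector.md` §9–§10, programme F2). Everything here is ABSTRACT: arc
weights `a : V → V → 𝔽₂` under the RECIPROCITY LAW `a s t + a t s = y_s y_t` (for Monsky's additive Legendre matrix: quadratic reciprocity,
`y = t = ((−1/pᵢ)₊)`), a second vector `z` (`= ((2/pᵢ)₊)`), in the vocabulary of the tree's bipartite all-minors forest formula (`bigN`, `lap`,
`treeDet = κ_t`, `qwt = q_x`, `fwt`, `setExp`). After the column swap, Monsky's even matrix is the doubled matrix `B = bigN a univ y z z`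
(marks `y`, roots `z`, extra roots `z`; tree `monskyMatrixEven_mul_swap`), and `adj(M_even)_{(inl i)(inr i)} = adj(B)_{(inr i)(inr i)}` is
the tree's rooted pointed forest sum (`adjugate_bigN_inr_inr`). This file evaluates that sum:

* §1 **MARKS INTO ROOTS** (`det_bigN_mark_eq`): under the reciprocity law on `D`,
  `det bigN a D y z z = (1 + Σ_D y) · det bigN a D z z 0` — a unimodular congruence turns `[[D_y, Pᵀ],[P, D_z]]` (`P = L_D + D_z`) into
  `[[D_z, L_Dᵀ],[L_D, D_z]] + u uᵀ` (`u = (y·1_D ; 0)`; `L + Lᵀ = y yᵀ + D_y` is the reciprocity law), the symmetric rank-one update costs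
  `Σ_j y_j adj_{(inl j)(inl j)}` (tree `det_add_vecMulVec_self`), which is the forest sum pointed by the additive weight `y` (tree
  `sum_mul_adjugate_bigN_inl`; on a block with `Σ_B y = 1` the weights `q_z` and `(Σ_B z) q_z` agree by flatness), i.e. `(Σ_D y)·det`.
* §2 **THE CRAMER DETERMINANT OF AN ODD BLOCK AS A FOREST SUM** (`det_updateCol_lap_eq_sum_odd`): for `Σ_{S} y = 1` and `i ∈ S`,
  `det((L_S + D_{y+z})[col i ← y·1_S]) = Σ_{i ∈ T ⊆ S, Σ_T y = 1} κ_i(T) · setExp(q_z)(S ∖ T)` — Cramer's column expansion, the cofactors of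
  `L_S + D_ℓ` as forest sums (second cofactor of the doubled matrix at `y = z = 0`, tree), the pinned expansion of `q_y` at `i` (tree
  `pinned_expansion_eq` on even blocks, flatness + the reciprocity lemma on odd ones), and `q_y + q_{y+z} = q_z`.
* §3 **(★)₆ IN FOREST FORM** (`adjugate_bigN_mark_inr_inr_eq_sum_odd`): for `Σ_D y = 1`, `i ∈ D`,
  `adj(bigN a D y z z)_{(inr i)(inr i)} = Σ_{i ∈ S ⊆ D, Σ_S y = 1} det((L_S + D_{y+z})[col i ← y·1_S]) · det(bigN a (D∖S) z z z)`.
The dictionary to Monsky's matrices (`det bigN a T z z z = det M_{d_T}` for `Σ_T y = 0`, the column swap, the census coordinates of the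
Cramer determinant) is the sibling file `…QFormIdentitySix`. Pure linear algebra over `𝔽₂`; no number theory, no `sorry`.
BSD is not proved by any of this; no class is closed.

References: [cite: Chaiken1982, §2 (all minors matrix tree theorem)]; [cite: Smith2016CongruentDensity, §2 Prop. 2.4, §2.2];
[cite: HeathBrown1994SelmerCongruentII, Appendix (Monsky), typescript p. 39 L27 – p. 41 L36]; [cite: HornJohnson2013, §0.8.5].
-/

namespace Summit.BirchSwinnertonDyer.PrintCf2.QFormForest

open Matrix Finset Literature.LinearAlgebra.Matrix Literature.Combinatorics.Enumerative
open Literature.NumberTheory.EllipticCurves.Smith2016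

variable {V : Type*} [Fintype V] [LinearOrder V]

/-! ## §1. Marks into roots: `det bigN a D y z z = (1 + Σ_D y) · det bigN a D z z 0` -/

omit [Fintype V] [LinearOrder V] in
/-- The rank-one matrix `(u; 0)(u; 0)ᵀ` on `V ⊕ V` is the block matrix `[[u uᵀ, 0],[0, 0]]`. [cite: HornJohnson2013, §0.8.5] -/
theorem vecMulVec_sum_elim_inl [DecidableEq V] (u : V → ZMod 2) :
    vecMulVec (Sum.elim u (0 : V → ZMod 2)) (Sum.elim u (0 : V → ZMod 2)) =
      fromBlocks (vecMulVec u u) (0 : Matrix V V (ZMod 2)) 0 0 := by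
  ext (i | i) (j | j) <;> simp [vecMulVec_apply]

omit [LinearOrder V] in
/-- **The congruence.** Under the reciprocity law on `D` (so that `L_D + L_Dᵀ = y yᵀ + D_y` on `D`): adding the root-copy rows of `D` to the
mark-copy rows and then the root-copy columns to the mark-copy columns turns `bigN a D y z z = [[D_y, (L_D + D_z)ᵀ],[L_D + D_z, D_z]]` into
`bigN a D z z 0 + u uᵀ = [[D_z + u uᵀ, L_Dᵀ],[L_D, D_z]]`, `u = (y·1_D ; 0)`.
[cite: HeathBrown1994SelmerCongruentII, Appendix (Monsky), typescript p. 39 L36–L41 (law (31): A + Aᵀ = D₋₁ + u uᵀ)] [cite: HornJohnson2013, §0.8.5] -/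
theorem congr_bigN_mark_eq [DecidableEq V] (a : V → V → ZMod 2) (y z : V → ZMod 2) {D : Finset V}
    (hrec : ∀ i ∈ D, ∀ j ∈ D, i ≠ j → a i j + a j i = y i * y j) :
    fromBlocks (1 : Matrix V V (ZMod 2)) (diagonal fun i => if i ∈ D then (1 : ZMod 2) else 0) 0 1 * bigN a D y z z *
        fromBlocks (1 : Matrix V V (ZMod 2)) 0 (diagonal fun i => if i ∈ D then (1 : ZMod 2) else 0) 1 =
      bigN a D z z 0 + vecMulVec (Sum.elim (fun i => if i ∈ D then y i else 0) (0 : V → ZMod 2))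
        (Sum.elim (fun i => if i ∈ D then y i else 0) (0 : V → ZMod 2)) := by
  have hsq : ∀ x : ZMod 2, x * x = x := by decide
  have h2 : ∀ x : ZMod 2, x + x = 0 := fun x => CharTwo.add_self_eq_zero x
  rw [vecMulVec_sum_elim_inl]
  unfold bigN
  rw [fromBlocks_multiply, fromBlocks_multiply, fromBlocks_add]
  simp only [Matrix.one_mul, Matrix.mul_one, Matrix.zero_mul, Matrix.mul_zero, zero_add, add_zero]
  -- the four blocks, entrywise
  have hP : ∀ i j, lapIn a D z i j + (if i = j then (if i ∈ D then z i else 0) else 0) = lapIn a D 0 i j := by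
    intro i j
    rw [lapIn_apply, lapIn_apply]
    by_cases hD : i ∈ D ∧ j ∈ D
    · rw [if_pos hD, if_pos hD]
      by_cases hij : i = j
      · subst hij; rw [if_pos rfl, if_pos rfl, if_pos rfl, if_pos hD.1, Pi.zero_apply, zero_add]
        linear_combination h2 (z i)
      · rw [if_neg hij, if_neg hij, if_neg hij, add_zero]
    · rw [if_neg hD, if_neg hD, zero_add]
      by_cases hij : i = j
      · subst hij
        rw [if_pos rfl, if_neg (fun h => hD ⟨h, h⟩)]
      · rw [if_neg hij]
  have hDz : (diagonal fun i => if i ∈ D then z i else (1 : ZMod 2)) * (diagonal fun i => if i ∈ D then (1 : ZMod 2) else 0) =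
      diagonal fun i => if i ∈ D then z i else 0 := by
    rw [diagonal_mul_diagonal]
    congr 1; funext i; split_ifs <;> simp
  have hzD : (diagonal fun i => if i ∈ D then (1 : ZMod 2) else 0) * (diagonal fun i => if i ∈ D then z i else (1 : ZMod 2)) =
      diagonal fun i => if i ∈ D then z i else 0 := by
    rw [diagonal_mul_diagonal]
    congr 1; funext i; split_ifs <;> simp
  have h21 : lapIn a D z + (diagonal fun i => if i ∈ D then z i else (1 : ZMod 2)) *
      (diagonal fun i => if i ∈ D then (1 : ZMod 2) else 0) = lapIn a D 0 := by
    rw [hDz]; ext i j; rw [Matrix.add_apply, diagonal_apply]; exact hP i j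
  have h12 : (lapIn a D z)ᵀ + (diagonal fun i => if i ∈ D then (1 : ZMod 2) else 0) *
      (diagonal fun i => if i ∈ D then z i else (1 : ZMod 2)) = (lapIn a D 0)ᵀ := by
    rw [hzD]; ext i j; rw [Matrix.add_apply, transpose_apply, transpose_apply, diagonal_apply]
    have := hP j i
    by_cases hij : i = j
    · subst hij; simpa using this
    · rw [if_neg hij]; rw [if_neg (Ne.symm hij)] at this; exact this
  refine Matrix.fromBlocks_inj.mpr ⟨?_, h12, h21, rfl⟩
  · -- the mark block: `D_y + X L + (Lᵀ X + (X D_z) X) = D_z + u uᵀ`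
    rw [Matrix.add_mul, diagonal_mul_diagonal]
    ext i j
    simp only [Matrix.add_apply, diagonal_apply, vecMulVec_apply, mul_diagonal, diagonal_mul, transpose_apply, lapIn_apply]
    by_cases hi : i ∈ D
    · by_cases hj : j ∈ D
      · simp only [hi, hj, and_self, if_true, one_mul, mul_one]
        by_cases hij : i = j
        · subst hij
          simp only [if_true]
          rw [hsq]
          linear_combination h2 (∑ k ∈ D.erase i, a i k) + h2 (z i)
        · rw [if_neg hij, if_neg hij, if_neg (Ne.symm hij), if_neg hij]
          have h := hrec i hi j hj hij
          linear_combination h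
      · have hij : i ≠ j := fun h => hj (h ▸ hi)
        simp [hi, hj, hij]
    · by_cases hj : j ∈ D
      · have hij : i ≠ j := fun h => hi (h ▸ hj)
        simp [hi, hj, hij]
      · by_cases hij : i = j
        · subst hij; simp [hi]
        · simp [hi, hj, hij]

omit [LinearOrder V] in
/-- The congruence matrices are unimodular, so `det bigN a D y z z = det (bigN a D z z 0 + u uᵀ)`. [cite: HornJohnson2013, §0.8.5] -/
theorem det_bigN_mark_eq_det_add_vecMulVec [DecidableEq V] (a : V → V → ZMod 2) (y z : V → ZMod 2) {D : Finset V}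
    (hrec : ∀ i ∈ D, ∀ j ∈ D, i ≠ j → a i j + a j i = y i * y j) :
    (bigN a D y z z).det = (bigN a D z z 0 + vecMulVec (Sum.elim (fun i => if i ∈ D then y i else 0) (0 : V → ZMod 2))
        (Sum.elim (fun i => if i ∈ D then y i else 0) (0 : V → ZMod 2))).det := by
  rw [← congr_bigN_mark_eq a y z hrec]
  simp only [det_mul, det_fromBlocks_zero₂₁, det_fromBlocks_zero₁₂, det_one, mul_one, one_mul]

/-- **Flatness makes the two pointed weights agree**: under the reciprocity law on `B`, `(Σ_B y) · q_z(B) = (Σ_B y) · fwt a z z 0 B`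
(`fwt a z z 0 B = (Σ_B z) q_z(B)`; on an odd block `q_z(B) = (Σ_B z) κ(B)` and `(Σ_B z)² = Σ_B z`).
[cite: Smith2016CongruentDensity, §2.2 (chunk p0008 L42–L50: all cofactors of a block d ≡ 3 (4) agree)] -/
theorem sum_mul_qwt_eq_sum_mul_fwt_zero_root (a : V → V → ZMod 2) (y z : V → ZMod 2) {B : Finset V}
    (hrec : ∀ i ∈ B, ∀ j ∈ B, i ≠ j → a i j + a j i = y i * y j) :
    (∑ i ∈ B, y i) * qwt a z B = (∑ i ∈ B, y i) * fwt a z z 0 B := by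
  by_cases hodd : ∑ i ∈ B, y i = 1
  · obtain ⟨c, hc⟩ := nonempty_of_sum_eq_one hodd
    rw [fwt_zero_root_apply, qwt_eq_sum_mul_treeDet_of_odd a y z hrec hodd hc]
    have h : ∀ u v : ZMod 2, u * v = u * (u * v) := by decide
    rw [← h]
  · have h0 : ∑ i ∈ B, y i = 0 := by
      have h01 : ∀ u : ZMod 2, u ≠ 1 → u = 0 := by decide
      exact h01 _ hodd
    rw [h0, zero_mul, zero_mul]

/-- **MARKS INTO ROOTS.** Under the reciprocity law on `D`: `det bigN a D y z z = (1 + Σ_D y) · det bigN a D z z 0` — in forest terms,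
`Σ_π ∏_B (1 + Σ_B y) q_z(B) = (1 + Σ_D y) · Σ_π ∏_B (Σ_B z) q_z(B)`. In particular both vanish on an odd `D`, and on an EVEN `D` the
partitions into even blocks weighted by `q_z` and all partitions weighted by `(Σ_B z) q_z(B)` have the same total.
[cite: Chaiken1982, §2 (all minors matrix tree theorem)] [cite: HornJohnson2013, §0.8.5 (rank-one update), §0.8.2] -/
theorem det_bigN_mark_eq (a : V → V → ZMod 2) (y z : V → ZMod 2) {D : Finset V}
    (hrec : ∀ i ∈ D, ∀ j ∈ D, i ≠ j → a i j + a j i = y i * y j) :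
    (bigN a D y z z).det = (1 + ∑ i ∈ D, y i) * (bigN a D z z 0).det := by
  classical
  rw [det_bigN_mark_eq_det_add_vecMulVec a y z hrec, det_add_vecMulVec_self (bigN_transpose a D z z 0)]
  rw [Fintype.sum_sum_type]
  simp only [Sum.elim_inr, Pi.zero_apply, zero_mul, sum_const_zero, add_zero, Sum.elim_inl]
  -- the pointed sum over the mark copies of `D`
  have hsum : ∑ j, (if j ∈ D then y j else 0) * (bigN a D z z 0).adjugate (Sum.inl j) (Sum.inl j) =
      ∑ j ∈ D, y j * (bigN a D z z 0).adjugate (Sum.inl j) (Sum.inl j) := by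
    have hite : ∀ j, (if j ∈ D then y j else 0) * (bigN a D z z 0).adjugate (Sum.inl j) (Sum.inl j) =
        if j ∈ D then y j * (bigN a D z z 0).adjugate (Sum.inl j) (Sum.inl j) else 0 := by
      intro j; split_ifs <;> simp
    rw [Fintype.sum_congr _ _ hite, sum_ite_mem, univ_inter]
  rw [hsum, sum_mul_adjugate_bigN_inl]
  have hpt : ∑ B ∈ D.powerset, (∑ i ∈ B, y i) * qwt a z B * setExp (fwt a z z 0) (D \ B) =
      ∑ B ∈ D.powerset, (∑ i ∈ B, y i) * (fwt a z z 0 B * setExp (fwt a z z 0) (D \ B)) := by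
    refine sum_congr rfl fun B hB => ?_
    rw [mem_powerset] at hB
    rw [← mul_assoc, sum_mul_qwt_eq_sum_mul_fwt_zero_root a y z (hrec_mono hB hrec)]
  rw [hpt, setExp_point, ← det_bigN_eq_setExp]
  ring

/-- The even case: on `D` with `Σ_D y = 0`, `det bigN a D y z z = det bigN a D z z 0`. [cite: Chaiken1982, §2] -/
theorem det_bigN_mark_eq_of_even (a : V → V → ZMod 2) (y z : V → ZMod 2) {D : Finset V}
    (hrec : ∀ i ∈ D, ∀ j ∈ D, i ≠ j → a i j + a j i = y i * y j) (hyD : ∑ i ∈ D, y i = 0) :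
    (bigN a D y z z).det = (bigN a D z z 0).det := by
  rw [det_bigN_mark_eq a y z hrec, hyD, add_zero, one_mul]


/-! ## §2. The Cramer determinant of an odd block as a forest sum -/

/-- **The cofactors of `L_S + D_ℓ` as forest sums**: for `i, r ∈ S`,
`adj(lap a S ℓ)_{i r} = Σ_{C ∋ i, r; C ⊆ S} κ_r(C) · setExp(q_ℓ)(S ∖ C)` — the tree containing `i` converges to `r`, every other tree
carries one `ℓ`-root (the second cofactor of the doubled matrix at `y = z = 0`, tree `det_unitize_unitize_bigN_inl_inr` +
`det_unitize_unitize_bigN_zero_zero`). [cite: Chaiken1982, §2 (all minors matrix tree theorem, the minor deleting one row and one column)] -/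
theorem adjugate_lap_eq_sum (a : V → V → ZMod 2) (ℓ : V → ZMod 2) {S : Finset V} {i r : V} (hi : i ∈ S) (hr : r ∈ S) :
    (lap a S ℓ).adjugate i r =
      ∑ B₀ ∈ (S.erase r).powerset.filter (fun B₀ => i ∈ insert r B₀), treeDet a (insert r B₀) r * setExp (qwt a ℓ) (S.erase r \ B₀) := by
  rw [← det_unitize_unitize_bigN_zero_zero a ℓ hi hr, det_unitize_unitize_bigN_inl_inr a hi hr 0 0 ℓ, fwt_zero_zero]
  have h0 : ∑ B₀ ∈ (S.erase r).powerset.filter (fun B₀ => i ∉ insert r B₀),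
      (∑ m ∈ insert r B₀, (0 : V → ZMod 2) m) * treeDet a (insert r B₀) r *
        ∑ B₁ ∈ (((S.erase r) \ B₀).erase i).powerset, qwt a 0 (insert i B₁) *
          setExp (qwt a ℓ) ((((S.erase r) \ B₀).erase i) \ B₁) = 0 := by
    refine sum_eq_zero fun B₀ _ => ?_
    simp only [Pi.zero_apply, sum_const_zero, zero_mul]
  rw [h0, add_zero]

/-- **Cramer's column expansion against the forest cofactors**: for `i ∈ S` and any vector `v`,
`det((lap a S ℓ)[col i ← v·1_S]) = Σ_{i ∈ C ⊆ S} q_v(C) · setExp(q_ℓ)(S ∖ C)` (the tree of `i` takes its root weight from `v`).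
[cite: HornJohnson2013, §0.8.2 (cofactor expansion)] [cite: Chaiken1982, §2] -/
theorem det_updateCol_lap_eq_sum_qwt (a : V → V → ZMod 2) (ℓ v : V → ZMod 2) {S : Finset V} {i : V} (hi : i ∈ S) :
    ((lap a S ℓ).updateCol i (fun r => if r ∈ S then v r else 0)).det =
      ∑ C₀ ∈ (S.erase i).powerset, qwt a v (insert i C₀) * setExp (qwt a ℓ) (S.erase i \ C₀) := by
  rw [det_updateCol_eq_adjugate_mulVec, mulVec, dotProduct]
  -- only `r ∈ S` contribute
  have hite : ∀ r, (lap a S ℓ).adjugate i r * (if r ∈ S then v r else 0) =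
      if r ∈ S then v r * (lap a S ℓ).adjugate i r else 0 := by
    intro r; split_ifs <;> ring
  rw [Fintype.sum_congr _ _ hite, sum_ite_mem, univ_inter]
  -- insert the cofactor formula and regroup by the block `C = {r} ∪ B₀ ∋ i`
  have hr : ∀ r ∈ S, v r * (lap a S ℓ).adjugate i r =
      ∑ B₀ ∈ (S.erase r).powerset, v r * (if i ∈ insert r B₀ then treeDet a (insert r B₀) r * setExp (qwt a ℓ) (S \ insert r B₀) else 0) := by
    intro r hr
    rw [adjugate_lap_eq_sum a ℓ hi hr, sum_filter, mul_sum]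
    refine sum_congr rfl fun B₀ _ => ?_
    rw [erase_sdiff_eq_sdiff_insert]
  rw [sum_congr rfl hr, sum_sum_powerset_erase_insert S
    (fun r C => v r * (if i ∈ C then treeDet a C r * setExp (qwt a ℓ) (S \ C) else 0))]
  -- the inner sum over `r ∈ C` is `q_v(C)` when `i ∈ C`
  have hC : ∀ C ∈ S.powerset, ∑ r ∈ C, v r * (if i ∈ C then treeDet a C r * setExp (qwt a ℓ) (S \ C) else 0) =
      if i ∈ C then qwt a v C * setExp (qwt a ℓ) (S \ C) else 0 := by
    intro C _
    by_cases hiC : i ∈ C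
    · simp only [if_pos hiC]
      rw [qwt, sum_mul]
      exact sum_congr rfl fun r _ => by ring
    · simp only [if_neg hiC, mul_zero, sum_const_zero]
  rw [sum_congr rfl hC, ← sum_filter, sum_powerset_filter_mem_eq _ hi]
  exact sum_congr rfl fun C₀ _ => by rw [erase_sdiff_eq_sdiff_insert]

/-- **The pinned expansion of `q_y` at `i`, both parities**: under the reciprocity law on `C ∋ i`,
`q_y(C) = Σ_{i ∈ T ⊆ C} (Σ_T y) · κ_i(T) · setExp(q_y)(C ∖ T)` — for `Σ_C y = 0` this is the tree's `pinned_expansion_eq` at `x = y`; for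
`Σ_C y = 1` the left side is `κ_i(C)` (flatness), which is the term `T = C`, and every other term has an even nonempty complement
`C ∖ T`, killed by the reciprocity lemma `setExp(q_y)(E) = (Σ_E y) q_y(E)`.
[cite: Smith2016CongruentDensity, §2.2 case 5(b) (source cnc2.tex l. 36–40)] [cite: Chaiken1982, §2] -/
theorem qwt_eq_sum_pinned (a : V → V → ZMod 2) (y : V → ZMod 2) {C : Finset V}
    (hrec : ∀ s ∈ C, ∀ j ∈ C, s ≠ j → a s j + a j s = y s * y j) {i : V} (hi : i ∈ C) :
    qwt a y C = ∑ B₀ ∈ (C.erase i).powerset,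
      (∑ m ∈ insert i B₀, y m) * treeDet a (insert i B₀) i * setExp (qwt a y) (C.erase i \ B₀) := by
  by_cases hyC : ∑ m ∈ C, y m = 0
  · rw [pinned_expansion_eq a y y hrec hyC hi, hyC, zero_mul, add_zero]
  have hyC1 : ∑ m ∈ C, y m = 1 := by
    have h01 : ∀ u : ZMod 2, u ≠ 0 → u = 1 := by decide
    exact h01 _ hyC
  -- the term `T = C`
  have hmem : C.erase i ∈ (C.erase i).powerset := mem_powerset_self _
  rw [← add_sum_erase _ _ hmem, insert_erase hi, hyC1, one_mul, sdiff_self, bot_eq_empty, setExp_empty, mul_one,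
    qwt_eq_sum_mul_treeDet_of_odd a y y hrec hyC1 hi, hyC1, one_mul]
  -- every other term vanishes
  rw [sum_eq_zero, add_zero]
  intro B₀ hB₀
  obtain ⟨hne, hB₀⟩ := mem_erase.mp hB₀
  rw [mem_powerset] at hB₀
  by_cases hyB : ∑ m ∈ insert i B₀, y m = 1
  · -- the complement is even and nonempty
    have hsplit := sum_eq_sum_insert_add_sum_sdiff y hi hB₀
    rw [hyC1, hyB] at hsplit
    have hE0 : ∑ m ∈ C.erase i \ B₀, y m = 0 := by
      have e : ∀ u : ZMod 2, 1 = 1 + u → u = 0 := by decide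
      exact e _ hsplit
    have hEne : (C.erase i \ B₀).Nonempty := by
      rw [nonempty_iff_ne_empty]
      intro h
      rw [sdiff_eq_empty_iff_subset] at h
      exact hne (subset_antisymm hB₀ h)
    rw [setExp_qwt_eq_sum_mul_qwt a y hEne (hrec_mono ((sdiff_subset).trans (erase_subset i C)) hrec), hE0, zero_mul,
      mul_zero]
  · have h0 : ∑ m ∈ insert i B₀, y m = 0 := by
      have h01 : ∀ u : ZMod 2, u ≠ 1 → u = 0 := by decide
      exact h01 _ hyB
    rw [h0, zero_mul, zero_mul]

omit [Fintype V] [LinearOrder V] in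
/-- Set bookkeeping for the regrouping `C₀ = B₀ ⊔ E`: `(B₀ ∪ E) ∖ B₀ = E` and `T ∖ (B₀ ∪ E) = (T ∖ B₀) ∖ E` for `E ⊆ T ∖ B₀`.
[cite: Stanley1999EC2, Cor. 5.1.6 (exponential formula; elementary finite form)] -/
theorem union_sdiff_bookkeeping [DecidableEq V] {T B₀ E : Finset V} (hE : E ⊆ T \ B₀) :
    (B₀ ∪ E) \ B₀ = E ∧ T \ (B₀ ∪ E) = (T \ B₀) \ E := by
  refine ⟨union_sdiff_cancel_left (disjoint_of_subset_right hE disjoint_sdiff), ?_⟩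
  rw [sdiff_sdiff_left, sup_eq_union]

/-- **THE CRAMER DETERMINANT OF AN ODD BLOCK AS A FOREST SUM.**  Under the reciprocity law on `S` with `Σ_S y = 1` and `i ∈ S`:
`det((L_S + D_{y+z})[col i ← y·1_S]) = Σ_{i ∈ T ⊆ S} (Σ_T y) · κ_i(T) · setExp(q_z)(S ∖ T)` — one tree containing `i`, converging to `i`,
of odd `y`-content; all other trees `z`-rooted. (Cramer's expansion against the forest cofactors gives `Σ_{C ∋ i} q_y(C) setExp(q_{y+z})(S∖C)`;
the pinned expansion of `q_y(C)` at `i` and `setExp(q_y) ⋆ setExp(q_{y+z}) = setExp(q_y + q_{y+z}) = setExp(q_z)` finish.) For Monsky's data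
`L_S + D_{y+z} = A_S + D₋₂` and `y = ((−1/p)₊)`: this is the Cramer determinant `det((A_S + D₋₂)[col i ← t_S])` of (★)₆.
[cite: Chaiken1982, §2 (all minors matrix tree theorem)] [cite: HornJohnson2013, §0.8.2] [cite: Stanley1999EC2, Cor. 5.1.6] -/
theorem det_updateCol_lap_eq_sum_odd (a : V → V → ZMod 2) (y z : V → ZMod 2) {S : Finset V}
    (hrec : ∀ s ∈ S, ∀ j ∈ S, s ≠ j → a s j + a j s = y s * y j) {i : V} (hi : i ∈ S) :
    ((lap a S (fun j => y j + z j)).updateCol i (fun r => if r ∈ S then y r else 0)).det =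
      ∑ B₀ ∈ (S.erase i).powerset,
        (∑ m ∈ insert i B₀, y m) * treeDet a (insert i B₀) i * setExp (qwt a z) (S.erase i \ B₀) := by
  classical
  rw [det_updateCol_lap_eq_sum_qwt a _ y hi]
  -- pinned expansion of `q_y` on every block `{i} ∪ C₀`
  have hpin : ∀ C₀ ∈ (S.erase i).powerset, qwt a y (insert i C₀) * setExp (qwt a fun j => y j + z j) (S.erase i \ C₀) =
      ∑ B₀ ∈ C₀.powerset, (∑ m ∈ insert i B₀, y m) * treeDet a (insert i B₀) i * setExp (qwt a y) (C₀ \ B₀) *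
        setExp (qwt a fun j => y j + z j) (S.erase i \ C₀) := by
    intro C₀ hC₀
    rw [mem_powerset] at hC₀
    have hiC₀ : i ∉ C₀ := fun h => notMem_erase i S (hC₀ h)
    have hsub : insert i C₀ ⊆ S := insert_subset hi (hC₀.trans (erase_subset i S))
    rw [qwt_eq_sum_pinned a y (hrec_mono hsub hrec) (mem_insert_self i C₀), erase_insert hiC₀, sum_mul]
  rw [sum_congr rfl hpin, sum_powerset_sum_powerset_sub]
  refine sum_congr rfl fun B₀ hB₀ => ?_
  -- regroup the complement `E = C₀ ∖ B₀` and convolve the two exponentials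
  have hE : ∀ E ∈ ((S.erase i) \ B₀).powerset,
      (∑ m ∈ insert i B₀, y m) * treeDet a (insert i B₀) i * setExp (qwt a y) ((B₀ ∪ E) \ B₀) *
          setExp (qwt a fun j => y j + z j) (S.erase i \ (B₀ ∪ E)) =
        (∑ m ∈ insert i B₀, y m) * treeDet a (insert i B₀) i *
          (setExp (qwt a y) E * setExp (qwt a fun j => y j + z j) (((S.erase i) \ B₀) \ E)) := by
    intro E hE
    rw [mem_powerset] at hE
    obtain ⟨h1, h2⟩ := union_sdiff_bookkeeping hE
    rw [h1, h2]
    ring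
  rw [sum_congr rfl hE, ← mul_sum, ← setExp_add]
  congr 1
  refine setExp_congr fun B _ _ => ?_
  rw [Pi.add_apply, qwt_add]
  have h2 : ∀ u v : ZMod 2, u + v + u = v := by decide
  exact h2 _ _

/-! ## §3. (★)₆ in forest form -/

/-- `fwt a z z 0 = fwt a z z z + q_z` (`(Σ_B z) q_z(B) = ((Σ_B z) q_z(B) + q_z(B)) + q_z(B)` in characteristic `2`). [cite: Chaiken1982, §2] -/
theorem fwt_zero_root_eq_fwt_self_add_qwt (a : V → V → ZMod 2) (z : V → ZMod 2) : fwt a z z 0 = fwt a z z z + qwt a z := by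
  funext B
  rw [Pi.add_apply, fwt_zero_root_apply, fwt]
  have h2 : ∀ u v : ZMod 2, u * v = u * v + v + v := by decide
  exact h2 _ _

/-- **(★)₆ IN FOREST FORM.**  Under the reciprocity law on `D` with `Σ_D y = 1` and `i ∈ D`:
`adj(bigN a D y z z)_{(inr i)(inr i)} = Σ_{S₀ ⊆ D∖i} (Σ_{S} y) · det((L_S + D_{y+z})[col i ← y·1_S]) · det(bigN a (D ∖ S) z z z)`, `S = {i} ∪ S₀`
— the root-copy cofactor of the doubled matrix with marks `y` (for Monsky's data: the `(inl i, inr i)` cofactor of the EVEN matrix after the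
column swap) is the sum over the ODD blocks `S ∋ i` of the Cramer determinant of the block times the symmetric Monsky form of the (even)
co-block. Proof: the rooted pointed forest sum (tree `adjugate_bigN_inr_inr`) has block weight `(1 + Σ_B y) q_z(B)`; marks into roots (§1)
turn the complement's `setExp` into that of `(Σ_B z) q_z(B) = fwt a z z z + q_z`, whose exponential is the convolution of `det bigN(·) z z z`
with `setExp(q_z)`; regrouping the `q_z`-part with the pointed odd block gives the Cramer determinant (§2).
[cite: Chaiken1982, §2] [cite: HeathBrown1994SelmerCongruentII, Appendix (Monsky), typescript p. 41 L20–L36] [cite: Stanley1999EC2, Cor. 5.1.6] -/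
theorem adjugate_bigN_mark_inr_inr_eq_sum_odd (a : V → V → ZMod 2) (y z : V → ZMod 2) {D : Finset V}
    (hrec : ∀ s ∈ D, ∀ j ∈ D, s ≠ j → a s j + a j s = y s * y j) (hyD : ∑ m ∈ D, y m = 1) {i : V} (hi : i ∈ D) :
    (bigN a D y z z).adjugate (Sum.inr i) (Sum.inr i) =
      ∑ S₀ ∈ (D.erase i).powerset, (∑ m ∈ insert i S₀, y m) *
        ((lap a (insert i S₀) (fun j => y j + z j)).updateCol i (fun r => if r ∈ insert i S₀ then y r else 0)).det *
          (bigN a (D.erase i \ S₀) z z z).det := by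
  classical
  rw [adjugate_bigN_inr_inr a hi y z z]
  -- marks into roots on every complement, then split `fwt a z z 0 = fwt a z z z + q_z`
  have hstep : ∀ B₀ ∈ (D.erase i).powerset,
      (∑ m ∈ insert i B₀, y m) * treeDet a (insert i B₀) i * setExp (fwt a y z z) (D.erase i \ B₀) =
        ∑ E ∈ ((D.erase i) \ B₀).powerset, (∑ m ∈ insert i B₀, y m) * treeDet a (insert i B₀) i *
          setExp (qwt a z) ((B₀ ∪ E) \ B₀) * (bigN a (D.erase i \ (B₀ ∪ E)) z z z).det := by
    intro B₀ hB₀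
    rw [mem_powerset] at hB₀
    have hR : D.erase i \ B₀ ⊆ D := (sdiff_subset).trans (erase_subset i D)
    have hsplit := sum_eq_sum_insert_add_sum_sdiff y hi hB₀
    rw [hyD] at hsplit
    rw [← det_bigN_eq_setExp, det_bigN_mark_eq a y z (hrec_mono hR hrec), ← mul_assoc,
      show (∑ m ∈ insert i B₀, y m) * treeDet a (insert i B₀) i * (1 + ∑ m ∈ D.erase i \ B₀, y m) =
        (∑ m ∈ insert i B₀, y m) * treeDet a (insert i B₀) i from by
          have e : ∀ c κ r : ZMod 2, 1 = c + r → c * κ * (1 + r) = c * κ := by decide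
          exact e _ _ _ hsplit,
      det_bigN_eq_setExp, fwt_zero_root_eq_fwt_self_add_qwt, setExp_add, mul_sum]
    refine sum_congr rfl fun E hE => ?_
    rw [mem_powerset] at hE
    obtain ⟨h1, h2⟩ := union_sdiff_bookkeeping hE
    rw [h1, h2, ← det_bigN_eq_setExp]
    ring
  have hψ := sum_powerset_sum_powerset_sub (D.erase i) (fun B₀ C₀ => (∑ m ∈ insert i B₀, y m) * treeDet a (insert i B₀) i *
    setExp (qwt a z) (C₀ \ B₀) * (bigN a (D.erase i \ C₀) z z z).det)
  beta_reduce at hψ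
  rw [sum_congr rfl hstep, ← hψ]
  refine sum_congr rfl fun S₀ hS₀ => ?_
  rw [mem_powerset] at hS₀
  have hiS₀ : i ∉ S₀ := fun h => notMem_erase i D (hS₀ h)
  have hsub : insert i S₀ ⊆ D := insert_subset hi (hS₀.trans (erase_subset i D))
  by_cases hyS : ∑ m ∈ insert i S₀, y m = 1
  · -- odd block: the inner sum is the Cramer determinant (§2)
    rw [hyS, one_mul, det_updateCol_lap_eq_sum_odd a y z (hrec_mono hsub hrec) (mem_insert_self i S₀), erase_insert hiS₀, sum_mul]
  · -- even block: the co-block is odd and nonempty, its symmetric Monsky form is singular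
    have hyS0 : ∑ m ∈ insert i S₀, y m = 0 := by
      have h01 : ∀ u : ZMod 2, u ≠ 1 → u = 0 := by decide
      exact h01 _ hyS
    have hsplit := sum_eq_sum_insert_add_sum_sdiff y hi hS₀
    rw [hyD, hyS0, zero_add] at hsplit
    have hR : D.erase i \ S₀ ⊆ D := (sdiff_subset).trans (erase_subset i D)
    rw [hyS0, zero_mul, zero_mul,
      det_bigN_self_eq_zero a y z _ (hrec_mono hR hrec) (nonempty_of_sum_eq_one hsplit.symm) (Or.inl hsplit.symm)]
    exact sum_eq_zero fun B₀ _ => by rw [mul_zero]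

end Summit.BirchSwinnertonDyer.PrintCf2.QFormForest
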